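import Literature.Barriers.ValiantsHypothesis.KroneckerPositivityHardness
import Literature.NumberTheory.DiophantineGeometry.KroneckerXRayEmbedding
import Literature.Computability.Complexity.DiscreteTomographyHardness
import HarnessLib

/-!
# KRONECKER is NP-hard (Ikenmeyer–Mulmuley–Walter 2017, Thm. 1.1): the Karp reduction from
# 2D-X-RAY, proved correct, and the assembly from the tree's two leaves

Sibling proof file of `KroneckerPositivityHardness.lean` (barrier catalogue `ValiantsHypothesis`)
for the named fact `IMW2017_kroneckerNPHard : IsNPHard KroneckerPositivity`.

Source: C. Ikenmeyer, K. D. Mulmuley, M. Walter, *On vanishing of Kronecker coefficients*,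
Comput. Complexity 26 (2017) 949–992 = arXiv:1507.02955 (held; read pp. 1–13), §3: "Thus it
follows at once from Theorem 3.2, in conjunction with this result [Theorem 3.3], that: Theorem 3.4.
The problem of deciding positivity of the Kronecker coefficient `k^λ_{μ,π}`, given `λ, μ` and `π`
in unary, is NP-hard with respect to polynomial-time Karp reductions … This proves Theorem 1.1."
In the net of reductions of Fischer–Ikenmeyer 2020 (§6, Fig. 2; held) the same theorem reads
`2D-X-RAY → KRONECKER`, the arrow being the simplex embedding of Brunetti–Del Lungo–Gérard 2001
(Thm. 3.1, proof; held) in the general form of FI 2020, Thm. 5.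

**State of the tree and what this file adds.** The complexity-theoretic leaf is already in the
tree: `Literature.Computability.Complexity.GGP1999_twoDXRayNPHard : IsNPHard TWODXRAY`
(Gardner–Gritzmann–Prangenberg 1999; `DiscreteTomographyHardness.lean`, a named fact, with
`isNPHard_of_TWODXRAY_reducible` for composing). The combinatorics of the simplex embedding is
proved (`Literature/Combinatorics/Enumerative/DiscreteTomography.lean`: marginals, simplex, layer,
exchange lemma), the representation theory is proved (`KroneckerPointSets.lean`: IMW Lemma 2.3 /
Cor. 2.4 / Lemma 3.1 / Thm. 3.2 in positivity form), and the mathematics of the arrow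
`2D-X-RAY → KRONECKER` is proved (`KroneckerXRayEmbedding.lean`: an admissible instance is
consistent iff `t > 0` iff `k > 0` for its Kronecker triple). Here:

* the STRING-LEVEL reduction map `xrayToKronecker : List Bool → List Bool` (codes of admissible
  2D-X-RAY instances ↦ unary KRONECKER codes `⟨λ, μ, π⟩` of their simplex embedding; all other
  words ↦ a fixed NO-instance `noCode`);
* its correctness `mem_TWODXRAY_iff_xrayToKronecker_mem : w ∈ TWODXRAY ↔ xrayToKronecker w ∈
  KroneckerPositivity`, PROVED (unique decodability of the unary code of
  `KroneckerPositivityHardness.lean`, `encodePartition_triple_inj`; the symmetry of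
  `kroneckerCoeff`; `noCode ∉ KroneckerPositivity`; consistent instances are admissible);
* the single residual named fact `FischerIkenmeyer2020_xrayToKronecker_mem_FP :
  xrayToKronecker ∈ FP` — the printed "polynomial-time" of this transformation, the only part of
  the arrow that is machine-level;
* the assembly `IMW2017_kroneckerNPHard_of_GGP : GGP1999_twoDXRayNPHard →
  FischerIkenmeyer2020_xrayToKronecker_mem_FP → IMW2017_kroneckerNPHard`.

So `IMW2017_kroneckerNPHard_holds` is exactly the conjunction of the two discharges (the GGP
circuit-board reduction from 1-IN-3-SAT, and a polynomial-time machine for `xrayToKronecker`).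

## References

* [IkenmeyerMulmuleyWalter2017] §3 (Thms. 3.2–3.4), Thm. 1.1.
* [BrunettiDelLungoGerard2001] S. Brunetti, A. Del Lungo, Y. Gérard, Linear Algebra Appl. 339
  (2001) 59–73, Thm. 3.1 and its proof ("a polynomial-time transformation").
* [FischerIkenmeyer2020] N. Fischer, C. Ikenmeyer, Comput. Complexity 29 (2020) 8, §6 (2D-X-RAY,
  Fig. 2), §7 (Thm. 5).
* [GardnerGritzmann1999] R. J. Gardner, P. Gritzmann, in: Herman–Kuba (eds.), Discrete Tomography
  (1999), Thm. 4.4.4 (the leaf, via `DiscreteTomographyHardness.lean`).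
-/

noncomputable section

namespace Literature.Barriers.ValiantsHypothesis

open Literature.Computability.Complexity Literature.Computability.Complexity.Classes
  Literature.Computability.Complexity.Nondeterministic Literature.NumberTheory.DiophantineGeometry
  Literature.Combinatorics.Enumerative.Tomography

/-! ### Unique decodability of the unary encoding -/

/-- `unaryList (a :: l) = unaryNat a ++ unaryList l`. [folklore] -/
theorem unaryList_cons (a : ℕ) (l : List ℕ) : unaryList (a :: l) = unaryNat a ++ unaryList l := by
  simp [unaryList, List.append_assoc]

/-- `unaryList [] = [false]` (the terminating empty block). [folklore] -/
theorem unaryList_nil : unaryList [] = [false] := rfl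

/-- Blocks of `1`s followed by a `0` are uniquely decodable: `1^a 0 u = 1^b 0 v` forces `a = b` and
`u = v`. [folklore] -/
theorem replicate_true_append_inj {a b : ℕ} {u v : List Bool}
    (h : List.replicate a true ++ false :: u = List.replicate b true ++ false :: v) : a = b ∧ u = v := by
  induction a generalizing b with
  | zero =>
    cases b with
    | zero => simpa using h
    | succ b => simp [List.replicate_succ] at h
  | succ a ih =>
    cases b with
    | zero => simp [List.replicate_succ] at h
    | succ b =>
      simp only [List.replicate_succ, List.cons_append, List.cons.injEq, true_and] at h
      obtain ⟨h1, h2⟩ := ih h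
      exact ⟨by rw [h1], h2⟩

/-- **The unary code of a list of positive naturals is self-delimiting**: if
`unaryList l ++ s = unaryList l' ++ s'` with all entries of `l, l'` positive then `l = l'` and
`s = s'`. [folklore] -/
theorem unaryList_append_inj {l l' : List ℕ} (hl : ∀ a ∈ l, 0 < a) (hl' : ∀ a ∈ l', 0 < a)
    {s s' : List Bool} (h : unaryList l ++ s = unaryList l' ++ s') : l = l' ∧ s = s' := by
  induction l generalizing l' with
  | nil =>
    cases l' with
    | nil =>
      rw [unaryList_nil] at h
      simpa using h
    | cons b l'' =>
      exfalso
      have hb : 0 < b := hl' b (by simp)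
      obtain ⟨b', rfl⟩ := Nat.exists_eq_succ_of_ne_zero hb.ne'
      rw [unaryList_nil, unaryList_cons, unaryNat] at h
      simp [List.replicate_succ] at h
  | cons a l₁ ih =>
    cases l' with
    | nil =>
      exfalso
      have ha : 0 < a := hl a (by simp)
      obtain ⟨a', rfl⟩ := Nat.exists_eq_succ_of_ne_zero ha.ne'
      rw [unaryList_nil, unaryList_cons, unaryNat] at h
      simp [List.replicate_succ] at h
    | cons b l₁' =>
      rw [unaryList_cons, unaryList_cons, unaryNat, unaryNat, List.append_assoc, List.append_assoc,
        List.append_assoc, List.append_assoc, List.singleton_append, List.singleton_append] at h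
      obtain ⟨hab, h'⟩ := replicate_true_append_inj h
      obtain ⟨h1, h2⟩ := ih (fun x hx => hl x (List.mem_cons_of_mem a hx))
        (fun x hx => hl' x (List.mem_cons_of_mem b hx)) h'
      exact ⟨by rw [hab, h1], h2⟩

/-- The unary code of a partition determines its sorted parts and the rest of the word.
[folklore] -/
theorem encodePartition_append_inj {D D' : ℕ} {lam : Nat.Partition D} {lam' : Nat.Partition D'}
    {s s' : List Bool} (h : encodePartition lam ++ s = encodePartition lam' ++ s') :
    lam.sortedParts = lam'.sortedParts ∧ s = s' :=
  unaryList_append_inj (fun _ ha => lam.pos_of_mem_sortedParts ha)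
    (fun _ ha => lam'.pos_of_mem_sortedParts ha) h

/-- Partitions with the same sorted parts have the same size. [folklore] -/
theorem size_eq_of_sortedParts_eq {D D' : ℕ} {lam : Nat.Partition D} {lam' : Nat.Partition D'}
    (h : lam.sortedParts = lam'.sortedParts) : D = D' := by
  rw [← lam.sum_sortedParts, ← lam'.sum_sortedParts, h]

/-- Partitions of the same size with the same sorted parts are equal. [folklore] -/
theorem eq_of_sortedParts_eq {D : ℕ} {lam lam' : Nat.Partition D}
    (h : lam.sortedParts = lam'.sortedParts) : lam = lam' := by
  apply Nat.Partition.ext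
  rw [← Multiset.sort_eq lam.parts (· ≥ ·), ← Multiset.sort_eq lam'.parts (· ≥ ·)]
  exact congrArg _ h

/-- **Unique decodability of KRONECKER instances**: the unary code `⟨λ, μ, π⟩` determines the
three sorted part lists. [folklore] -/
theorem encodePartition_triple_inj {D D' : ℕ} {lam μ π : Nat.Partition D}
    {lam' μ' π' : Nat.Partition D'}
    (h : encodePartition lam ++ encodePartition μ ++ encodePartition π =
      encodePartition lam' ++ encodePartition μ' ++ encodePartition π') :
    lam.sortedParts = lam'.sortedParts ∧ μ.sortedParts = μ'.sortedParts ∧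
      π.sortedParts = π'.sortedParts := by
  rw [List.append_assoc, List.append_assoc] at h
  obtain ⟨h1, h⟩ := encodePartition_append_inj h
  obtain ⟨h2, h⟩ := encodePartition_append_inj h
  have h' : encodePartition π ++ [] = encodePartition π' ++ [] := by rw [List.append_nil, List.append_nil, h]
  obtain ⟨h3, -⟩ := encodePartition_append_inj h'
  exact ⟨h1, h2, h3⟩

/-- Membership in `KroneckerPositivity` of a code `⟨λ, μ, π⟩` is positivity of `g(λ, μ, π)`
(unique decodability and the symmetry of the Kronecker coefficients). [folklore] -/
theorem encode_mem_kroneckerPositivity_iff {D : ℕ} (lam μ π : Nat.Partition D) :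
    encodePartition lam ++ encodePartition μ ++ encodePartition π ∈ KroneckerPositivity ↔
      0 < kroneckerCoeff ℂ lam μ π := by
  constructor
  · rintro ⟨D', lam', μ', π', hcode, hk'⟩
    obtain ⟨h1, h2, h3⟩ := encodePartition_triple_inj hcode
    obtain rfl : D = D' := size_eq_of_sortedParts_eq h1
    obtain rfl : lam = lam' := eq_of_sortedParts_eq h1
    obtain rfl : μ = μ' := eq_of_sortedParts_eq h2
    obtain rfl : π = π' := eq_of_sortedParts_eq h3
    rw [kroneckerCoeff_comm₁₂_holds ℂ lam μ π, kroneckerCoeff_comm₂₃_holds ℂ μ lam π]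
    exact hk'
  · intro hk
    refine ⟨D, lam, μ, π, rfl, ?_⟩
    rw [kroneckerCoeff_comm₂₃_holds ℂ μ π lam, kroneckerCoeff_comm₁₂_holds ℂ μ lam π]
    exact hk

/-! ### A fixed NO-instance of KRONECKER -/

/-- The column `(1, 1) ⊢ 2`. [folklore] -/
def columnTwo : Nat.Partition 2 := (Nat.Partition.indiscrete 2).transpose

/-- The unary code of `⟨(1,1), (1,1), (1,1)⟩`: a NO-instance of KRONECKER
(`k((1,1),(1,1),(1,1)) = 0`: two distinct points of `ℕ³` cannot all lie in the planes `x = 0`,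
`y = 0`, `z = 0`; the multiplicity of `sgn` in `sgn ⊗ sgn = triv` is `0`). [folklore] -/
def noCode : List Bool :=
  encodePartition columnTwo ++ encodePartition columnTwo ++ encodePartition columnTwo

/-- The column `(1,1)` has one column, of length `2`. [folklore] -/
theorem colLen_columnTwo (i : ℕ) : columnTwo.youngDiagram.colLen i = if i = 0 then 2 else 0 := by
  rw [← getD_sortedParts_transpose, columnTwo, Nat.Partition.transpose_transpose,
    sortedParts_indiscrete two_ne_zero]
  cases i with
  | zero => rfl
  | succ i => simp

/-- No point set has marginals `((2), (2), (2))`. [folklore] -/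
theorem not_hasMarginals_columnTwo (P : Finset Point3) : ¬ HasMarginals P columnTwo columnTwo columnTwo := by
  intro h
  have hcard := h.card_eq
  obtain ⟨hx, hy, hz⟩ := h
  have hsub : P ⊆ {((0 : ℕ), (0 : ℕ), (0 : ℕ))} := by
    intro p hp
    rw [Finset.mem_singleton]
    have h1 : 0 < xMarginal P p.1 := Finset.card_pos.2 ⟨p, Finset.mem_filter.2 ⟨hp, rfl⟩⟩
    have h2 : 0 < yMarginal P p.2.1 := Finset.card_pos.2 ⟨p, Finset.mem_filter.2 ⟨hp, rfl⟩⟩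
    have h3 : 0 < zMarginal P p.2.2 := Finset.card_pos.2 ⟨p, Finset.mem_filter.2 ⟨hp, rfl⟩⟩
    rw [hx, colLen_columnTwo] at h1
    rw [hy, colLen_columnTwo] at h2
    rw [hz, colLen_columnTwo] at h3
    have e1 : p.1 = 0 := by by_contra hne; rw [if_neg hne] at h1; exact lt_irrefl 0 h1
    have e2 : p.2.1 = 0 := by by_contra hne; rw [if_neg hne] at h2; exact lt_irrefl 0 h2
    have e3 : p.2.2 = 0 := by by_contra hne; rw [if_neg hne] at h3; exact lt_irrefl 0 h3
    exact Prod.ext e1 (Prod.ext e2 e3)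
  have := Finset.card_le_card hsub
  rw [Finset.card_singleton, hcard] at this
  exact absurd this (by norm_num)

/-- `noCode ∉ KroneckerPositivity`. [folklore] -/
theorem noCode_not_mem : noCode ∉ KroneckerPositivity := by
  intro h
  rw [noCode, encode_mem_kroneckerPositivity_iff] at h
  obtain ⟨P, hP⟩ := exists_hasMarginals_of_kroneckerCoeff_pos ℂ h
  exact not_hasMarginals_columnTwo P hP

/-! ### The reduction map `2D-X-RAY → KRONECKER` -/

open scoped Classical in
/-- **The reduction map from 2D-X-RAY to KRONECKER** (BDLG 2001, Thm. 3.1; FI 2020, Thm. 5 and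
Fig. 2; IMW 2017, Thm. 3.4): a word that is the code (`encodingTwoDXRay`) of an ADMISSIBLE
instance `(μ', ν', ρ')` (`XRayAdmissible`, with `r + 1` = the common length) is sent to the unary
KRONECKER code `⟨λ, μ, π⟩` of its simplex embedding (`xrayLam`, `xrayMu`, `xrayPi`:
`λᵀ = X(P_r) + μ'` etc.); every other word (non-codes and inadmissible, hence inconsistent,
instances) is sent to the fixed NO-instance `noCode`. (The choice of the witness is irrelevant:
`encode` is injective.) [cite: FischerIkenmeyer2020, Theorem 5] -/
def xrayToKronecker (w : List Bool) : List Bool :=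
  if h : ∃ I : List ℕ × List ℕ × List ℕ, encodingTwoDXRay.encode I = w ∧
      XRayAdmissible (I.1.length - 1) I.1 I.2.1 I.2.2 then
    encodePartition (xrayLam (h.choose.1.length - 1) h.choose.1) ++
      encodePartition (xrayMu (h.choose.1.length - 1) h.choose.1 h.choose.2.1) ++
      encodePartition (xrayPi (h.choose.1.length - 1) h.choose.1 h.choose.2.2)
  else noCode

open scoped Classical in
/-- **Specification of the reduction map on code words** (for its future machine): the code of
`I = (μ', ν', ρ')` goes to the KRONECKER code of the simplex embedding if `I` is admissible (with
`r + 1 = |μ'|`), and to `noCode` otherwise. [cite: FischerIkenmeyer2020, Theorem 5] -/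
theorem xrayToKronecker_encode (I : List ℕ × List ℕ × List ℕ) :
    xrayToKronecker (encodingTwoDXRay.encode I) =
      if XRayAdmissible (I.1.length - 1) I.1 I.2.1 I.2.2 then
        encodePartition (xrayLam (I.1.length - 1) I.1) ++
          encodePartition (xrayMu (I.1.length - 1) I.1 I.2.1) ++
          encodePartition (xrayPi (I.1.length - 1) I.1 I.2.2)
      else noCode := by
  classical
  by_cases hadm : XRayAdmissible (I.1.length - 1) I.1 I.2.1 I.2.2
  · rw [if_pos hadm]
    have h : ∃ I' : List ℕ × List ℕ × List ℕ, encodingTwoDXRay.encode I' = encodingTwoDXRay.encode I ∧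
        XRayAdmissible (I'.1.length - 1) I'.1 I'.2.1 I'.2.2 := ⟨I, rfl, hadm⟩
    unfold xrayToKronecker
    rw [dif_pos h]
    have e : h.choose = I := encodingTwoDXRay.encode_injective h.choose_spec.1
    have key : ∀ J : List ℕ × List ℕ × List ℕ, J = I →
        encodePartition (xrayLam (J.1.length - 1) J.1) ++
            encodePartition (xrayMu (J.1.length - 1) J.1 J.2.1) ++
            encodePartition (xrayPi (J.1.length - 1) J.1 J.2.2) =
          encodePartition (xrayLam (I.1.length - 1) I.1) ++
            encodePartition (xrayMu (I.1.length - 1) I.1 I.2.1) ++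
            encodePartition (xrayPi (I.1.length - 1) I.1 I.2.2) := by
      rintro J rfl
      rfl
    exact key _ e
  · rw [if_neg hadm]
    unfold xrayToKronecker
    rw [dif_neg]
    rintro ⟨I', hI', hadm'⟩
    obtain rfl : I' = I := encodingTwoDXRay.encode_injective hI'
    exact hadm hadm'

/-- **Specification of the reduction map off code words**: words that are not codes of
2D-X-RAY instances go to `noCode`. [folklore] -/
theorem xrayToKronecker_of_not_exists {w : List Bool}
    (hw : ¬ ∃ I : List ℕ × List ℕ × List ℕ, encodingTwoDXRay.encode I = w) :
    xrayToKronecker w = noCode := by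
  classical
  unfold xrayToKronecker
  rw [dif_neg]
  rintro ⟨I, hI, -⟩
  exact hw ⟨I, hI⟩

/-- **Correctness of the reduction** (proved): `w ∈ TWODXRAY ↔ xrayToKronecker w ∈
KroneckerPositivity`. For the code of an admissible instance this is the simplex embedding
(`exists_layerSet_iff_kroneckerCoeff_pos`: BDLG Thm. 3.1 / FI Thm. 5 / IMW Thms. 3.2–3.4, via the
exchange lemma and the bounds `p > 0 ⇒ k > 0 ⇒ t > 0`) together with unique decodability; words
that are not codes of admissible instances are outside `TWODXRAY` (consistent instances are
admissible, `XRayAdmissible.of_layerSet`) and are mapped to `noCode ∉ KroneckerPositivity`.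
[cite: BrunettiDelLungoGerard2001, Thm. 3.1] [cite: FischerIkenmeyer2020, Theorem 5] -/
theorem mem_TWODXRAY_iff_xrayToKronecker_mem (w : List Bool) :
    w ∈ TWODXRAY ↔ xrayToKronecker w ∈ KroneckerPositivity := by
  classical
  unfold xrayToKronecker
  split_ifs with h
  · obtain ⟨hIw, hadm⟩ := h.choose_spec
    set I := h.choose with hI
    set r := I.1.length - 1 with hr
    rw [encode_mem_kroneckerPositivity_iff, ← exists_layerSet_iff_kroneckerCoeff_pos ℂ hadm, ← hIw,
      encode_mem_TWODXRAY_iff, mem_twoDXRaySet_iff]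
    constructor
    · rintro ⟨r', h1, h2, h3, S, hS, hx, hy, hz⟩
      have e : r' = r := by have := hadm.length₁; omega
      subst e
      exact ⟨S, hS, hx, hy, hz⟩
    · rintro ⟨S, hS, hx, hy, hz⟩
      exact ⟨r, hadm.length₁, hadm.length₂, hadm.length₃, S, hS, hx, hy, hz⟩
  · constructor
    · intro hw
      exfalso
      apply h
      obtain ⟨I, hI, hIw⟩ := (Set.mem_image _ _ _).1 hw
      obtain ⟨r, h1, h2, h3, S, hS, hx, hy, hz⟩ := hI
      refine ⟨I, hIw, ?_⟩
      have e : I.1.length - 1 = r := by omega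
      rw [e]
      exact XRayAdmissible.of_layerSet h1 h2 h3 hS hx hy hz
    · intro hno
      exact absurd hno noCode_not_mem

/-! ### The residual named fact and the assembly of Theorem 1.1 -/

/-- **The reduction map is polynomial-time** — the residual named fact of IMW Thm. 1.1 in this
tree. Printed: BDLG 2001, proof of Thm. 3.1: "we describe a polynomial-time transformation from
RESTRICTED CONSISTENCY_{F²}" (the simplex embedding, there for permutation instances); FI 2020, §6
Fig. 2 and Thm. 5 (the same embedding for arbitrary 2D-X-RAY instances, "2D-X-RAY → … Kronecker",
a polynomial-time many-one reduction); IMW 2017, Thm. 3.4 ("NP-hard with respect to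
polynomial-time Karp reductions", via this embedding). Rendered for the tree's concrete map
`xrayToKronecker` (house unary encodings on both sides, inadmissible inputs to a fixed
NO-instance) and the tree's `FP` (`PolyTimeComputable id id`): a discharge must exhibit a
polynomial-time `FinTM2`-style machine that parses `⟨μ', ⟨ν', ρ'⟩⟩`, checks admissibility, adds the
simplex marginals `X_i(P_r) = (r-i)(r-i+1)/2`, transposes (`λ_j = #{i : X_i > j}`) and writes the
three unary codes — all of size polynomial (cubic) in the input length. Everything else in
Thm. 1.1's proof is proved in the tree (`mem_TWODXRAY_iff_xrayToKronecker_mem`) or is the separate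
leaf `GGP1999_twoDXRayNPHard`. [cite: FischerIkenmeyer2020, Theorem 5 and §6 (Fig. 2)] [cite: BrunettiDelLungoGerard2001, Thm. 3.1 (proof: "polynomial-time transformation")] -/
def FischerIkenmeyer2020_xrayToKronecker_mem_FP : Prop :=
  xrayToKronecker ∈ FP

/-- **2D-X-RAY `≤ₚ` KRONECKER** from the residual fact: the map `xrayToKronecker` is a Karp
reduction (correctness proved, running time vendored). [cite: FischerIkenmeyer2020, §6 (Fig. 2)] -/
theorem TWODXRAY_karpReducible_kroneckerPositivity (h : FischerIkenmeyer2020_xrayToKronecker_mem_FP) :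
    PolyTimeKarpReducible TWODXRAY KroneckerPositivity :=
  ⟨xrayToKronecker, h, mem_TWODXRAY_iff_xrayToKronecker_mem⟩

/-- **IMW Thm. 1.1 from the two leaves**: KRONECKER is NP-hard, given the NP-hardness of 2D-X-RAY
(Gardner–Gritzmann–Prangenberg, `GGP1999_twoDXRayNPHard`) and the running time of the simplex
embedding (`FischerIkenmeyer2020_xrayToKronecker_mem_FP`); hardness propagates along the proved
Karp reduction (`isNPHard_of_TWODXRAY_reducible`). The discharge `IMW2017_kroneckerNPHard_holds` is
exactly the conjunction of the two discharges. [cite: IkenmeyerMulmuleyWalter2017, Thm. 1.1 and Thm. 3.4] -/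
theorem IMW2017_kroneckerNPHard_of_GGP (h₁ : GGP1999_twoDXRayNPHard)
    (h₂ : FischerIkenmeyer2020_xrayToKronecker_mem_FP) : IMW2017_kroneckerNPHard :=
  isNPHard_of_TWODXRAY_reducible h₁ (TWODXRAY_karpReducible_kroneckerPositivity h₂)

/-- The barrier conjunction from the two leaves and the Fischer–Ikenmeyer fact.
[cite: IkenmeyerMulmuleyWalter2017, Thm. 1.1] -/
theorem kroneckerPlethysmHardness_of_GGP (h₁ : GGP1999_twoDXRayNPHard)
    (h₂ : FischerIkenmeyer2020_xrayToKronecker_mem_FP) (hFI : FischerIkenmeyer2020_plethysmNPHard) :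
    KroneckerPlethysmHardness :=
  ⟨IMW2017_kroneckerNPHard_of_GGP h₁ h₂, hFI⟩

end Literature.Barriers.ValiantsHypothesis
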